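import Summits.HodgeConjecture.HodgeConjecture.Theorems.R90S1RamifiedShellZeroFibre                -- ★∕📤 (this seat) shell-zero fibres at e = 2; brings ★ `K2E3BranchBShellZeroFibres`, ★ `K2E3BranchBSkewLineIntegrals`, ★ `R90S1RamifiedFixedSkewShellGeometry`
import HarnessLib

/-!
# R90 · S1 ∕ U4Keys leaf (U4f-χ₁-ram-one-d0B) — THE SHELL-ONE `y`-FIBRES OF `E ∘ z` AT A TAME RAMIFIED PLACE: over `{y : |heisZ σ x y|_w = q_w}` the fibre is the SKEW-SPHERE
# CHARACTER INTEGRAL `∫_{|y|_w = q_w} χ₁(ŷ) dμ⁻` if `|x|_w ≤ 1` and `0` if `|x|_w > 1` — the reduction of the ramified odd-shell identity `∫_{Sh 1} F₀ = 0` to ONE character integral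
# [Keys1984 §7 Thm (2) (d); Rogawski1990 §1.10, §12.2 (2); SerreLocalFields1979 Ch. IV §2 Prop. 5; PAPER-Z3-DepthZeroRamified §1 (R90-C10-p05 (g0), r01-screened)]

Cell `hodgecm-mathlib`, SLAB R90-TF, section S1 «Ch. 12 local», crux H413 = `stmt-HodgeConjecture-24833` (lane `--supports … --as helper`), route HCCMUnconditional; prover seat
`hodgecm-mathlib-R90-C10-p05` (g0); socket of record S1#3′ = K2E3 leaf (U4f-χ₁-ram-one) ⊇ U4Keys :155 (depth 0, Branch B).  THEOREMS ONLY (no definition ∕ instance ∕ notation ∕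
named fact ∕ `sorry`); ★-only imports.  FRAME (v1 spellings, as ★ `K2E3BranchBShellZeroFibres`): `R := LocalRing L v`, `σ := conjLocal L c v`, `R⁻ = skewPart σ`; `v` non-split (`hw`),
`w ∣ v` RAMIFIED (`he`), `|2|_w = 1` (`h2w`, `[Invertible (2 : R)]`); the :155 letter `hdepth`; `μ⁻ = μY` any measure on `R⁻`; `E r := χ₁(r̂)` if `r ∈ Rˣ` else `0`.

THE POINT.  With `a = −½xσx` (`σ`-fixed, `|a|_w = |x|_w²`) and `y ∈ R⁻`: `|a + y|_w = q_w ⟺ |y|_w = q_w ∧ |a|_w ≤ 1` (★ `valued_fixed_add_skew_eq_exp_one_iff_ram`: fixed elements have even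
order), i.e. `⟺ |y|_w = q_w ∧ |x|_w ≤ 1`; on that set `a + y = y·(1 + a∕y)` with `|a∕y|_w ≤ q_w⁻¹`, so `E(a + y) = χ₁(ŷ)·χ₁(1 + a∕y) = χ₁(ŷ) = E(y)` (`hdepth`).  Hence the shell-one fibre
over `x` is the skew-sphere character integral `∫_{|y|_w = q_w} E(y) dμ⁻` for EVERY `|x|_w ≤ 1` (independent of `x`) and `0` for `|x|_w > 1`; the odd-shell identity `h1` of ★
`R90S1KeysThmTwoDepthZeroBranchBRamified` is thereby reduced to `∫_{y ∈ R⁻ : |y|_w = q_w} χ₁(ŷ) dμ⁻ = 0` (`y = θ⁻¹b`, `b` a FIXED unit, `χ₁|_{𝒪_F^×} = λ ≠ 1` quadratic by `hB` + `hram`,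
`Σ_{𝔽_q^×} λ = 0`) plus the (II)-type `x`-assembler.
* §1 `valued_heisZ_apply_eq_exp_one_iff_ram` (`|heisZ σ x y|_w = q_w ⟺ |y|_w = q_w ∧ |x|_w ≤ 1`).
* §2 **`heisZFibreOne_eq_skewSphereIntegral_ram`** (`|x|_w ≤ 1`), **`heisZFibreOne_eq_zero_of_one_lt_valued_ram`** (`|x|_w > 1`).
HONEST LABEL.  HC_CM is proved only modulo the 7 printed citations (2 remaining named inputs: hLiu418 = `stmt-HodgeConjecture-24832`, h413 = `stmt-HodgeConjecture-24833`) until rung 0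
closes; count-neutral — this file does NOT pay the leaf; no printed citation is discharged.

## References
* [Keys1984] D. Keys, *Principal series representations of special unitary groups over local fields*, Compositio Math. 51 (1984), §4–§5, §7 Theorem (2) (d) p. 126.
* [Rogawski1990] J. D. Rogawski, *Automorphic Representations of Unitary Groups in Three Variables*, Ann. of Math. Stud. 123 (1990), §1.10 p. 9, §12.2 (2) p. 173.
* [SerreLocalFields1979] J.-P. Serre, *Local Fields*, GTM 67 (1979), Ch. III §6, Ch. IV §2 Prop. 5.
-/

set_option autoImplicit false
-- the mandated namespace has the single-problem summit's repeated segment (`HodgeConjecture.HodgeConjecture`)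
set_option linter.dupNamespace false

noncomputable section

open NumberField IsDedekindDomain MeasureTheory Measure Topology Set
open scoped NNReal ENNReal
open Literature.NumberTheory Literature.NumberTheory.Automorphic Literature.NumberTheory.Automorphic.UnitaryGroup

namespace Summit.HodgeConjecture.HodgeConjecture.R90.S1

open Summit.HodgeConjecture.HodgeConjecture.Cruxes.H413
open Summit.HodgeConjecture.HodgeConjecture.Cruxes.H413.K2E3BranchBSkewUnitSign
open Summit.HodgeConjecture.HodgeConjecture.Cruxes.H413.K2E3BranchBSkewLineIntegrals
open Summit.HodgeConjecture.HodgeConjecture.Cruxes.H413.K2E3BranchBShellZeroFibres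

variable (L : Type) [Field L] [NumberField L] [IsCMField L] (v : HeightOneSpectrum (𝓞 ↥(maximalRealSubfield L)))
  (w : PlacesOver L v) (hw : IsCMField.complexConj L • w.1 = w.1)

/-! ## §1 Shell-one membership in the chart `z = heisZ σ x y` at a tame ramified place -/

include hw in
/-- **SHELL ONE IN THE CHART: `|heisZ σ x y|_w = q_w ⟺ |y|_w = q_w ∧ |x|_w ≤ 1`** (`q_w = exp 1`; `y ∈ R⁻`) at a tame ramified place: `heisZ σ x y = a + y`, `a = −½xσx` fixed with
`|a|_w = |x|_w²` (★ `conj_half_mul_conj_and_valued`), `(σ r)_w = σ_w(r_w)` (★ `conjLocal_apply_eq_of_smul_eq`), ★ `valued_fixed_add_skew_eq_exp_one_iff_ram`, and `|x|_w² ≤ 1 ⟺ |x|_w ≤ 1`.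
[cite: Rogawski1990, §1.10 p. 9] [cite: SerreLocalFields1979, Ch. III §6, Ch. IV §2 Prop. 5] -/
theorem valued_heisZ_apply_eq_exp_one_iff_ram [Invertible (2 : LocalRing L v)] (he : v.asIdeal.ramificationIdx' w.1.asIdeal ≠ 1)
    (h2w : Valued.v (2 : w.1.adicCompletion L) = 1) (x : LocalRing L v) (y : ↥(HeisRing.skewPart (conjLocal L (IsCMField.complexConj L) v))) :
    Valued.v ((HeisRing.heisZ (conjLocal L (IsCMField.complexConj L) v) x y) w) = WithZero.exp (1 : ℤ) ↔
      Valued.v ((y : LocalRing L v) w) = WithZero.exp (1 : ℤ) ∧ Valued.v (x w) ≤ 1 := by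
  haveI : Algebra.IsQuadraticExtension ↥(maximalRealSubfield L) L := IsCMField.isQuadraticExtension L
  obtain ⟨hfix, hval⟩ := conj_half_mul_conj_and_valued L v w hw h2w x
  have hσa : galAdicCompletionMap (L := L) (IsCMField.complexConj L) hw ((-(⅟ (2 : LocalRing L v) * (x * conjLocal L (IsCMField.complexConj L) v x))) w) =
      (-(⅟ (2 : LocalRing L v) * (x * conjLocal L (IsCMField.complexConj L) v x))) w := by
    rw [← conjLocal_apply_eq_of_smul_eq (IsCMField.complexConj L) (IsCMField.complexConj_ne_one L) v w hw, hfix]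
  have hyskew : conjLocal L (IsCMField.complexConj L) v (y : LocalRing L v) = -(y : LocalRing L v) := y.2
  have hσy : galAdicCompletionMap (L := L) (IsCMField.complexConj L) hw ((y : LocalRing L v) w) = -((y : LocalRing L v) w) := by
    rw [← conjLocal_apply_eq_of_smul_eq (IsCMField.complexConj L) (IsCMField.complexConj_ne_one L) v w hw (y : LocalRing L v), hyskew, Pi.neg_apply]
  rw [heisZ_eq_neg_half_add, Pi.add_apply, valued_fixed_add_skew_eq_exp_one_iff_ram L w hw he h2w hσa hσy, hval]
  refine and_congr_right fun _ => ⟨fun h => le_of_not_gt fun hgt => absurd h (not_le.2 (Left.one_lt_mul' hgt hgt)), fun h => mul_le_one' h h⟩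

/-! ## §2 The two shell-one fibres -/

section Fibres

variable [MeasurableSpace (LocalRing L v)] (μY : Measure ↥(HeisRing.skewPart (conjLocal L (IsCMField.complexConj L) v)))

include hw in
open scoped Classical in
/-- **FIBRE `|x|_w ≤ 1` AT A TAME RAMIFIED PLACE: `∫_{y : |heisZ σ x y|_w = q_w} E(heisZ σ x y) dμ⁻ = ∫_{|y|_w = q_w} E(y) dμ⁻`** — the fibre set is the skew sphere `{|y|_w = q_w}` (§1),
on which `a + y = y·(1 + a∕y)` with `y ∈ Rˣ`, `|a∕y|_w ≤ q_w⁻¹ < 1`, so `E(a + y) = χ₁(ŷ)·χ₁((1 + a∕y)^) = χ₁(ŷ) = E(y)` (`hdepth`).  The sphere's Borel-ness is the letter `hS1`.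
[cite: Keys1984, §7 Theorem (2) (d) p. 126] [cite: Rogawski1990, §1.10 p. 9, §12.2 (2) p. 173] [cite: SerreLocalFields1979, Ch. IV §2 Prop. 5] -/
theorem heisZFibreOne_eq_skewSphereIntegral_ram [Invertible (2 : LocalRing L v)] (he : v.asIdeal.ramificationIdx' w.1.asIdeal ≠ 1)
    (h2w : Valued.v (2 : w.1.adicCompletion L) = 1) (χ₁ : (LocalRing L v)ˣ →* ℂˣ)
    (hdepth : ∀ u : (LocalRing L v)ˣ, (∀ w' : PlacesOver L v, Valued.v (((u : LocalRing L v) w') - 1) < 1) → χ₁ u = 1)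
    (hS1 : MeasurableSet {y : ↥(HeisRing.skewPart (conjLocal L (IsCMField.complexConj L) v)) | Valued.v ((y : LocalRing L v) w) = WithZero.exp (1 : ℤ)})
    {x : LocalRing L v} (hx : Valued.v (x w) ≤ 1) :
    ∫ y in {y : ↥(HeisRing.skewPart (conjLocal L (IsCMField.complexConj L) v)) |
        Valued.v ((HeisRing.heisZ (conjLocal L (IsCMField.complexConj L) v) x (y : LocalRing L v)) w) = WithZero.exp (1 : ℤ)},
        (fun r : LocalRing L v => if h : IsUnit r then ((χ₁ h.unit : ℂˣ) : ℂ) else 0)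
          (HeisRing.heisZ (conjLocal L (IsCMField.complexConj L) v) x (y : LocalRing L v)) ∂μY =
      ∫ y in {y : ↥(HeisRing.skewPart (conjLocal L (IsCMField.complexConj L) v)) | Valued.v ((y : LocalRing L v) w) = WithZero.exp (1 : ℤ)},
        (fun r : LocalRing L v => if h : IsUnit r then ((χ₁ h.unit : ℂˣ) : ℂ) else 0) (y : LocalRing L v) ∂μY := by
  -- the fibre set is the skew sphere `{|y|_w = exp 1}`
  have hset : {y : ↥(HeisRing.skewPart (conjLocal L (IsCMField.complexConj L) v)) |
        Valued.v ((HeisRing.heisZ (conjLocal L (IsCMField.complexConj L) v) x (y : LocalRing L v)) w) = WithZero.exp (1 : ℤ)} =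
      {y : ↥(HeisRing.skewPart (conjLocal L (IsCMField.complexConj L) v)) | Valued.v ((y : LocalRing L v) w) = WithZero.exp (1 : ℤ)} := by
    ext y
    simp only [Set.mem_setOf_eq, valued_heisZ_apply_eq_exp_one_iff_ram L v w hw he h2w x y, hx, and_true]
  rw [hset]
  obtain ⟨hfix, hval⟩ := conj_half_mul_conj_and_valued L v w hw h2w x
  set a : LocalRing L v := -(⅟ (2 : LocalRing L v) * (x * conjLocal L (IsCMField.complexConj L) v x)) with ha_def
  have hva : Valued.v (a w) ≤ 1 := by rw [hval]; exact mul_le_one' hx hx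
  have h01 : (1 : WithZero (Multiplicative ℤ)) ≤ WithZero.exp (1 : ℤ) := by
    rw [← WithZero.exp_zero, WithZero.exp_le_exp]; norm_num
  refine setIntegral_congr_fun hS1 fun y hy => ?_
  simp only [Set.mem_setOf_eq] at hy
  have hy0 : (y : LocalRing L v) w ≠ 0 := fun h0 => by rw [h0, map_zero] at hy; exact WithZero.zero_ne_coe hy
  have huy : IsUnit (y : LocalRing L v) := K2E3DepthZeroIwahoriCharacterCM.isUnit_of_apply_ne_zero L v w hw _ hy0
  have hz : HeisRing.heisZ (conjLocal L (IsCMField.complexConj L) v) x (y : LocalRing L v) = a + (y : LocalRing L v) := by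
    rw [heisZ_eq_neg_half_add]
  have hzw : Valued.v ((a + (y : LocalRing L v)) w) = WithZero.exp (1 : ℤ) := by
    rw [valued_add_apply_eq_max L v w hw h2w hfix y.2, hy]
    exact max_eq_right (hva.trans h01)
  have huz : IsUnit (a + (y : LocalRing L v)) :=
    K2E3DepthZeroIwahoriCharacterCM.isUnit_of_apply_ne_zero L v w hw _ (fun h0 => by rw [h0, map_zero] at hzw; exact WithZero.zero_ne_coe hzw)
  simp only [hz, dif_pos huz, dif_pos huy]
  -- `(a + y)^ = ŷ · u₁` with `u₁ = ŷ⁻¹ (a + y)^` principal: `(u₁)_w − 1 = y_w⁻¹ a_w`, of valuation `≤ q_w⁻¹ < 1`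
  have hprin : χ₁ (huy.unit⁻¹ * huz.unit) = 1 := by
    refine hdepth _ (forall_placesOver_of_apply L v w hw
      (P := fun w' => Valued.v ((((huy.unit⁻¹ * huz.unit : (LocalRing L v)ˣ) : LocalRing L v) w') - 1) < 1) ?_)
    have hinv : ((huy.unit⁻¹ : (LocalRing L v)ˣ) : LocalRing L v) w * (y : LocalRing L v) w = 1 := by
      have h := congrFun huy.unit.inv_mul w
      rw [Pi.mul_apply, IsUnit.unit_spec, Pi.one_apply] at h
      exact h
    have hyinv : ((huy.unit⁻¹ : (LocalRing L v)ˣ) : LocalRing L v) w = ((y : LocalRing L v) w)⁻¹ := eq_inv_of_mul_eq_one_left hinv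
    have hcalc : (((huy.unit⁻¹ * huz.unit : (LocalRing L v)ˣ) : LocalRing L v) w) - 1 = ((y : LocalRing L v) w)⁻¹ * a w := by
      rw [Units.val_mul, Pi.mul_apply, IsUnit.unit_spec, hyinv, Pi.add_apply, mul_add, inv_mul_cancel₀ hy0, add_sub_cancel_right]
    show Valued.v ((((huy.unit⁻¹ * huz.unit : (LocalRing L v)ˣ) : LocalRing L v) w) - 1) < 1
    rw [hcalc, map_mul, map_inv₀, hy]
    calc (WithZero.exp (1 : ℤ))⁻¹ * Valued.v (a w) ≤ (WithZero.exp (1 : ℤ))⁻¹ * 1 := mul_le_mul_right hva _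
      _ = WithZero.exp (-1 : ℤ) := by rw [mul_one, WithZero.exp_neg]
      _ < 1 := by rw [← WithZero.exp_zero, WithZero.exp_lt_exp]; norm_num
  have hfac : huz.unit = huy.unit * (huy.unit⁻¹ * huz.unit) := by rw [mul_inv_cancel_left]
  rw [hfac, map_mul, hprin, mul_one]

include hw in
open scoped Classical in
/-- **FIBRE `|x|_w > 1` AT A TAME RAMIFIED PLACE: the shell-one `y`-fibre of `E ∘ z` is `0`** — the fibre set is EMPTY (§1 needs `|x|_w ≤ 1`).
[cite: Keys1984, §7 Theorem (2) (d) p. 126] [cite: Rogawski1990, §1.10 p. 9] -/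
theorem heisZFibreOne_eq_zero_of_one_lt_valued_ram [Invertible (2 : LocalRing L v)] (he : v.asIdeal.ramificationIdx' w.1.asIdeal ≠ 1)
    (h2w : Valued.v (2 : w.1.adicCompletion L) = 1) (χ₁ : (LocalRing L v)ˣ →* ℂˣ) {x : LocalRing L v} (hx : 1 < Valued.v (x w)) :
    ∫ y in {y : ↥(HeisRing.skewPart (conjLocal L (IsCMField.complexConj L) v)) |
        Valued.v ((HeisRing.heisZ (conjLocal L (IsCMField.complexConj L) v) x (y : LocalRing L v)) w) = WithZero.exp (1 : ℤ)},
        (fun r : LocalRing L v => if h : IsUnit r then ((χ₁ h.unit : ℂˣ) : ℂ) else 0)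
          (HeisRing.heisZ (conjLocal L (IsCMField.complexConj L) v) x (y : LocalRing L v)) ∂μY = 0 := by
  have hset : {y : ↥(HeisRing.skewPart (conjLocal L (IsCMField.complexConj L) v)) |
      Valued.v ((HeisRing.heisZ (conjLocal L (IsCMField.complexConj L) v) x (y : LocalRing L v)) w) = WithZero.exp (1 : ℤ)} = ∅ := by
    ext y
    simp only [Set.mem_setOf_eq, Set.mem_empty_iff_false, iff_false, valued_heisZ_apply_eq_exp_one_iff_ram L v w hw he h2w x y, not_and]
    intro _ hle; exact absurd hle (not_le.2 hx)
  rw [hset, Measure.restrict_empty, integral_zero_measure]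

end Fibres

end Summit.HodgeConjecture.HodgeConjecture.R90.S1

end
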